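import Summits.BirchSwinnertonDyer.Rank1Residual.Additive.SemistableTwistAnalyticOdd
import Summits.BirchSwinnertonDyer.Rank1Residual.Additive.PalTwistPeriodHolds
import Literature.NumberTheory.EllipticCurves.GaussSumJacobiChar
import HarnessLib

/-!
# The additive twist, SIGN PINNED: `L(E,1) = ϖ·(∑(a/p)[a/p]⁺_{f♭})·Ω_E` (`p ≡ 1 (mod 4)`) and
# `L(E,1) = ϖ⁻·(∑(a/p)[a/p]⁻_{f♭})·Ω_E/c_∞(E)` (`p ≡ 3 (mod 4)`) — Birch × Pal × Gauss's sign
# (cell `b2b-bsdres`, census cell, seat `b2b-bsdres-census-ctyper1`; support file of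
# `CensusX41Calibration.lean`)

HONEST FRAMING (cell `b2b-bsdres`, run/shared/lean/b2b/bsd-rank1-residual/, verbatim in every
file): the goal of the cell is to DELETE the COMBINATION-SHAPED residual classes of the
Birch–Swinnerton-Dyer formula for ALL analytic-rank `≤ 1` elliptic curves over `ℚ` — "full BSD
formula for every rank `≤ 1` curve in class `C`" assembled STRICTLY from published theorems — so
that the rank-`≤ 1` remainder becomes exactly the CONSTRUCTION-SHAPED classes, which are TYPED
(missing-input `Prop`s), NOT attempted. This is not "finishing BSD". Census cell (bsd-formula-census):
research instrumentation; census output = EVIDENCE / conjecture items, never a Literature fact;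
labels UNCHANGED; nothing booked. Theorems only (no definition, no named fact).

additive-p4's `entireLFunction_one_eq_of_twist` (`SemistableTwistAnalytic.lean`, `p ≡ 1 (mod 4)`) and
`entireLFunction_one_eq_of_twist_neg` (`SemistableTwistAnalyticOdd.lean`, `p ≡ 3 (mod 4)`) give, for
`E = W = C • V^{(p*)}` additive at `p` with `V = E♭` good or multiplicative at `p` (newform `f`,
period ratios `ϖ·Ω_V = Ω⁺_f`, `ϖ⁻·|Ω⁻(V)| = Ω⁻_f`): `L(E,1) = ε·ϖ·S⁺·Ω_E` resp.
`L(E,1) = ε·ϖ⁻·S⁻·Ω_E/(|u(C)|·c_∞(E))` with a SIGN `ε = ±1` left free (only `τ(χ_p)² = ±p` was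
used) and Pal's scaling `|u(C)|` explicit. The census campaign X4-1 (bsd-formula-census,
`X41-REPORT.md`) found the sign `+` and the scaling `1` on all 1552 pairs it computed; both are
theorems: Gauss's evaluation `τ(χ_p) = √p` (`p ≡ 1`) / `i√p` (`p ≡ 3 (mod 4)`) is in the tree
(`gaussSum_jacobiChar_of_mod_four_eq_one/three`, Montgomery–Vaughan Thm. 9.17), and `|u(C)| = 1`
for the twist by `−p` follows from `p`- and `ℓ`-minimality exactly as additive-p4's `+p` case
(`abs_u_eq_one_of_twist_prime_one_mod_four`). This file pins them:

* `numRealComponents_eq_of_twist` — `c_∞(C • V^{(d)}) = c_∞(V)` (`Δ` changes by `u⁻¹²d⁶ > 0`);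
* `abs_u_eq_one_of_twist_neg_prime_three_mod_four` — `|u(C)| = 1` for `W = C • V^{(−p)}`, both
  globally minimal, `V` semistable at `p ≡ 3 (mod 4)`;
* `entireLFunction_one_eq_of_twist_pos` — **`L(E,1) = ϖ·S⁺·Ω_E`** (`p ≡ 1 (mod 4)`);
* `entireLFunction_one_eq_of_twist_neg_signed` — **`L(E,1) = ϖ⁻·S⁻·Ω_E/c_∞(E)`** (`p ≡ 3 (mod 4)`).
Modularity (`hasEntireLFunction_rat`) is the only named input (Pal's `p ≡ 1` fact is discharged in
`PalTwistPeriodHolds.lean`, his `d < 0` case proved in `ImaginaryPeriod.lean`).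

References: Mazur–Tate–Teitelbaum 1986 §I.8 (8.6) [MazurTateTeitelbaum1986Invent]; Pal 2012 Thm. 3.2,
Prop. 2.5 [Pal2012]; Montgomery–Vaughan 2007 Thm. 9.17 [MontgomeryVaughan2007]; Cremona 1997 §2.8,
§3.7 [CremonaAlgorithms1997].
-/

noncomputable section

open scoped Classical MatrixGroups ModularForm

open CongruenceSubgroup WeierstrassCurve Literature.NumberTheory.EllipticCurves
  Literature.NumberTheory.EllipticCurves.ModularForms
  Literature.NumberTheory.EllipticCurves.Rank1Residual

namespace Summit.BirchSwinnertonDyer.Rank1Residual.Additive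

/-! ### §1 Bookkeeping: real components and the scaling of the twist model -/

section Bookkeeping

variable (p : ℕ) [hp : Fact p.Prime]

omit hp in
/-- **`c_∞(E) = c_∞(E♭)`** (census: 1552/1552): a quadratic twist and a change of variables over `ℚ`
do not change the number of real components, since `Δ(C • V^{(d)}) = u(C)⁻¹² · d⁶ · Δ(V)` has the
sign of `Δ(V)` (Cremona, *Algorithms* §3.7: two components iff `Δ > 0`). -/
theorem numRealComponents_eq_of_twist (V W : WeierstrassCurve ℚ) {d : ℚ} (hd : d ≠ 0)
    (C : VariableChange ℚ) (hC : C • V.quadraticTwist d = W) :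
    (W.baseChange ℝ).numRealComponents = (V.baseChange ℝ).numRealComponents := by
  subst hC
  rw [numRealComponents_baseChange_real, numRealComponents_baseChange_real, variableChange_Δ,
    quadraticTwist_Δ]
  have hu : (0 : ℚ) < C.u⁻¹ ^ 12 := by
    rw [show (12 : ℕ) = 2 * 6 by rfl, pow_mul]
    exact pow_pos (lt_of_le_of_ne (sq_nonneg _) (Ne.symm (pow_ne_zero _ (Units.ne_zero _)))) 6
  have hd6 : (0 : ℚ) < d ^ 6 := by
    rw [show (6 : ℕ) = 2 * 3 by rfl, pow_mul]
    exact pow_pos (lt_of_le_of_ne (sq_nonneg _) (Ne.symm (pow_ne_zero _ hd))) 3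
  simp only [mul_pos_iff_of_pos_left hu, mul_pos_iff_of_pos_left hd6]

/-- **`|u(C)| = 1` for the twist by `−p`, `p ≡ 3 (mod 4)`** (census: `u₋ = 2/c_∞` on 1188/1188 odd
rows, i.e. PARI's `Ω⁻(E♭) = √p · ω₁(E)`, Pal's `ũ = 1`): for `V` globally minimal, good or
multiplicative at `p`, and `W = C • V^{(−p)}` globally minimal, every `ℓ`-adic valuation of `u(C)`
vanishes — at `ℓ = p` because `V^{(−p)}` is already `p`-minimal
(`padicValRat_u_eq_zero_of_twist_pm_p`, Pal 2012 Prop. 2.5), at `ℓ ≠ p` because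
`Δ(W)·u¹² = p⁶·Δ(V)` while `v_ℓ(Δ_min W) = v_ℓ(Δ_min V)`, the twist by `−p ≡ 1 (mod 4)` being
unramified at `ℓ` (`padicValInt_minimalDiscriminantInt_eq_of_twist_pStar`). Twin of additive-p4's
`abs_u_eq_one_of_twist_prime_one_mod_four` (the `+p` case). [cite: Pal2012, Prop. 2.5, Thm. 3.2] -/
theorem abs_u_eq_one_of_twist_neg_prime_three_mod_four (hp4 : p % 4 = 3) (V W : WeierstrassCurve ℚ)
    [V.IsElliptic] [V.IsGloballyMinimal] [W.IsElliptic] [W.IsGloballyMinimal]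
    (hV : Good V p ∨ Mult V p) (C : VariableChange ℚ) (hC : C • V.quadraticTwist (-(p : ℚ)) = W) :
    |(C.u : ℚ)| = 1 := by
  have hp2 : p ≠ 2 := by rintro rfl; norm_num at hp4
  have hu0 : (C.u : ℚ) ≠ 0 := C.u.ne_zero
  have hCz : C • V.quadraticTwist ((-(p : ℤ) : ℤ) : ℚ) = W := by
    rwa [Int.cast_neg, Int.cast_natCast]
  refine Rat.abs_eq_one_of_forall_padicValRat_eq_zero hu0 fun ℓ hℓ => ?_
  haveI : Fact ℓ.Prime := ⟨hℓ⟩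
  by_cases hℓp : ℓ = p
  · subst hℓp
    exact padicValRat_u_eq_zero_of_twist_pm_p ℓ hp2 V W hV (Or.inr rfl) C hCz
  · -- `ℓ ≠ p`: compare discriminants
    have hdk : (-(p : ℤ)) = 4 * (-(((p / 4 : ℕ) : ℤ)) - 1) + 1 := by
      have := Nat.div_add_mod p 4; rw [hp4] at this; push_cast; omega
    have hmin :=
      padicValInt_minimalDiscriminantInt_eq_of_twist_pStar p V hdk (Or.inr rfl) C hCz hℓp
    -- `Δ(W) · u¹² = p⁶ · Δ(V)` as rationals (`(−p)⁶ = p⁶`)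
    have hΔ : W.Δ * (C.u : ℚ) ^ 12 = (p : ℚ) ^ 6 * V.Δ := by
      rw [← hC, variableChange_Δ, quadraticTwist_Δ, Units.val_inv_eq_inv_val, inv_pow]
      field_simp
    have hVΔ : V.Δ ≠ 0 := by rw [← V.coe_Δ']; exact V.Δ'.ne_zero
    have hWΔ : W.Δ ≠ 0 := by rw [← W.coe_Δ']; exact W.Δ'.ne_zero
    have hp0 : (p : ℚ) ≠ 0 := by exact_mod_cast hp.out.ne_zero
    have hval := congrArg (padicValRat ℓ) hΔ
    rw [padicValRat.mul hWΔ (pow_ne_zero _ hu0), padicValRat.mul (pow_ne_zero _ hp0) hVΔ,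
      padicValRat.pow, padicValRat.pow] at hval
    have hW' : padicValRat ℓ W.Δ = padicValRat ℓ V.Δ := by
      rw [← cast_minimalDiscriminantInt W, ← cast_minimalDiscriminantInt V, padicValRat.of_int,
        padicValRat.of_int, hmin]
    have hpv : padicValRat ℓ (p : ℚ) = 0 := by
      rw [padicValRat.of_nat, padicValNat_primes hℓp, Nat.cast_zero]
    rw [hW', hpv] at hval
    push_cast at hval
    linarith

end Bookkeeping

/-! ### §2 Birch × Pal × Gauss: the sign pinned -/

section Signed

open Literature.NumberTheory.QuadraticFields Rat.HeightOneSpectrum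

variable (p : ℕ) [hp : Fact p.Prime]

/-- **`p ≡ 1 (mod 4)`: `L(E, 1) = ϖ · (∑_{a mod p} (a/p)[a/p]⁺_{f♭}) · Ω_E`, no sign ambiguity.**
Setting of `entireLFunction_one_eq_of_twist` (`E = W = C • V^{(p)}` additive at `p`, `V = E♭` good
or multiplicative at `p` with newform `f`, `ϖ·Ω_V = Ω⁺_f`); that theorem gives `ε = ±1` from
`τ(χ_p)² = p`; Gauss's theorem `τ(χ_p) = +√p` (tree `gaussSum_jacobiChar_of_mod_four_eq_one`,
Montgomery–Vaughan Thm. 9.17) and Pal's relation `√p·Ω_E = Ω_V` (discharged,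
`pal2012_thm32_sqrt_mul_realPeriodRat_twist_eq_of_prime_one_mod_four_holds`) pin `ε = 1`. This is the
census's survivor on the rows `p ≡ 1 (mod 4)` read through the dictionary (`ϖ·S⁺ = L(E,1)/Ω_E`).
[cite: MazurTateTeitelbaum1986Invent, §I.8 (8.6)] [cite: Pal2012, Thm. 3.2] [cite: MontgomeryVaughan2007, Thm. 9.17] -/
theorem entireLFunction_one_eq_of_twist_pos (hmod : hasEntireLFunction_rat) (hp4 : p % 4 = 1)
    (V W : WeierstrassCurve ℚ) [V.IsElliptic] [V.IsGloballyMinimal] [W.IsElliptic]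
    [W.IsGloballyMinimal] (C : VariableChange ℚ) (hC : C • V.quadraticTwist (p : ℚ) = W)
    (hV : Good V p ∨ Mult V p) (hadd : Addv W p)
    {N : ℕ} [NeZero N] {f : CuspForm (Gamma0 N) 2} (hf : IsNewformOf V f)
    (ϖ : ℚ) (hϖ : (ϖ : ℝ) * V.realPeriodRat = plusPeriod f) :
    W.entireLFunction 1 = ((ϖ * legendrePlusSymbolSum f p : ℚ) : ℂ) * (W.realPeriodRat : ℂ) := by
  haveI : NeZero p := ⟨hp.out.ne_zero⟩
  have hp2 : p ≠ 2 := by omega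
  obtain ⟨-, hχq, hχprim⟩ := jacobiChar_prime_ne_one_isQuadratic_isPrimitive p hp2
  have hχe := jacobiChar_even_of_mod_four_eq_one p hp4
  set χ := jacobiChar p with hχdef
  have hE : W.HasEntireLFunction := hmod W
  -- [F]: the Dirichlet coefficients of `W` are those of `f ⊗ χ`
  have hco : ∀ n : ℕ, ((W.LFunction n : ℤ) : ℂ) = χ n * cuspCoeff f n :=
    fun n ↦ intCast_LFunction_eq_jacobiChar_mul_cuspCoeff p hp4 V W ⟨C, hC⟩ hadd hf n
  have hL' : ∀ s : ℂ, 2 < s.re → W.entireLFunction s = twistedLSeries f χ⁻¹ s := by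
    intro s hs
    rw [hχq.inv, W.entireLFunction_eq_LSeries hE (by linarith), LSeries_eq_twistedLSeries_of_coeff W f χ hco]
  -- Birch's formula: `S · Ω⁺_f = τ(χ) · L(W, 1)`
  have hB := ratTwistedSymbolSum_mul_plusPeriod_holds hf.1 hf.coeffField_eq_bot hχprim hχe
    (W.differentiable_entireLFunction hE) hL'
  rw [← cast_legendrePlusSymbolSum_eq_ratTwistedSymbolSum p f] at hB
  -- Gauss: `τ(χ) = √p`
  have hτ : gaussSum χ (ZMod.stdAddChar (N := p)) = (Real.sqrt p : ℂ) :=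
    gaussSum_jacobiChar_of_mod_four_eq_one hp.out.prime.squarefree hp4
  -- Pal (discharged): `√p · Ω_W = Ω_V`, and `ϖ Ω_V = Ω⁺_f`
  have hPal' : Real.sqrt p * W.realPeriodRat = V.realPeriodRat :=
    pal2012_thm32_sqrt_mul_realPeriodRat_twist_eq_of_prime_one_mod_four_holds V W p hp4 hV ⟨C, hC⟩
  have hper : (plusPeriod f : ℂ) = (ϖ : ℂ) * (Real.sqrt p : ℂ) * (W.realPeriodRat : ℂ) := by
    rw [← Complex.ofReal_ratCast, ← hϖ, ← hPal']
    push_cast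
    ring
  have hsqrt0 : ((Real.sqrt p : ℝ) : ℂ) ≠ 0 := by
    rw [Complex.ofReal_ne_zero]
    exact Real.sqrt_ne_zero'.mpr (by exact_mod_cast hp.out.pos)
  rw [hper, hτ] at hB
  -- `S ϖ √p Ω_W = √p L`
  have key : W.entireLFunction 1 =
      (legendrePlusSymbolSum f p : ℂ) * (ϖ : ℂ) * (W.realPeriodRat : ℂ) := by
    apply mul_left_cancel₀ hsqrt0
    linear_combination -hB
  rw [key]
  push_cast
  ring

/-- **`p ≡ 3 (mod 4)`: `L(E, 1) = ϖ⁻ · (∑_{a mod p} (a/p)[a/p]⁻_{f♭}) · Ω_E / c_∞(E)`, no sign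
ambiguity and no scaling factor.** Setting of `entireLFunction_one_eq_of_twist_neg`
(`E = W = C • V^{(−p)}` additive at `p`, `V = E♭` good or multiplicative at `p` with newform `f`,
`ϖ⁻·|Ω⁻(V)| = Ω⁻_f`, `c_∞(E)` the number of real components); that theorem gives
`L(E,1) = ε·ϖ⁻·S⁻·Ω_E/(|u(C)|·c_∞(E))` with `ε = ±1`; Gauss's theorem `τ(χ_p) = +i√p` (tree
`gaussSum_jacobiChar_of_mod_four_eq_three`) pins `ε = 1` and §1 gives `|u(C)| = 1`. This is the
census's survivor on the rows `p ≡ 3 (mod 4)` read through the dictionary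
(`ϖ⁻·S⁻ = c_∞(E)·L(E,1)/Ω_E`). [cite: MazurTateTeitelbaum1986Invent, §I.8 (8.6)]
[cite: Pal2012, Thm. 3.2] [cite: MontgomeryVaughan2007, Thm. 9.17] -/
theorem entireLFunction_one_eq_of_twist_neg_signed (hmod : hasEntireLFunction_rat) (hp4 : p % 4 = 3)
    (V W : WeierstrassCurve ℚ) [V.IsElliptic] [V.IsGloballyMinimal] [W.IsElliptic]
    [W.IsGloballyMinimal] (C : VariableChange ℚ) (hC : C • V.quadraticTwist (-(p : ℚ)) = W)
    (hV : Good V p ∨ Mult V p) (hadd : Addv W p)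
    {N : ℕ} [NeZero N] {f : CuspForm (Gamma0 N) 2} (hf : IsNewformOf V f)
    (ϖ : ℚ) (hϖ : (ϖ : ℝ) * V.imaginaryPeriodRat = minusPeriod f) :
    W.entireLFunction 1 =
      ((ϖ * legendreMinusSymbolSum f p / ((W.baseChange ℝ).numRealComponents : ℚ) : ℚ) : ℂ) *
        (W.realPeriodRat : ℂ) := by
  haveI : NeZero p := ⟨hp.out.ne_zero⟩
  have hp2 : p ≠ 2 := by omega
  obtain ⟨-, hχq, hχprim⟩ := jacobiChar_prime_ne_one_isQuadratic_isPrimitive p hp2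
  have hχo := jacobiChar_odd_of_mod_four_eq_three p hp4
  set χ := jacobiChar p with hχdef
  have hE : W.HasEntireLFunction := hmod W
  -- [F]: the Dirichlet coefficients of `W` are those of `f ⊗ χ`
  have hco : ∀ n : ℕ, ((W.LFunction n : ℤ) : ℂ) = χ n * cuspCoeff f n :=
    fun n ↦ intCast_LFunction_eq_jacobiChar_mul_cuspCoeff_of_neg p hp4 V W ⟨C, hC⟩ hadd hf n
  have hL' : ∀ s : ℂ, 2 < s.re → W.entireLFunction s = twistedLSeries f χ⁻¹ s := by
    intro s hs
    rw [hχq.inv, W.entireLFunction_eq_LSeries hE (by linarith), LSeries_eq_twistedLSeries_of_coeff W f χ hco]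
  -- odd Birch: `S⁻ · Ω⁻_f · i = τ(χ) · L(W, 1)`
  have hB := ratMinusTwistedSymbolSum_mul_minusPeriod_mul_I f hf.1 hf.coeffField_eq_bot hχprim hχo
    (W.differentiable_entireLFunction hE) hL'
  rw [← cast_legendreMinusSymbolSum_eq_ratMinusTwistedSymbolSum p f] at hB
  -- Gauss: `τ(χ) = i √p`
  have hτ : gaussSum χ (ZMod.stdAddChar (N := p)) = Complex.I * (Real.sqrt p : ℂ) :=
    gaussSum_jacobiChar_of_mod_four_eq_three hp.out.prime.squarefree hp4
  -- Pal (`d = −p < 0`, proved in the tree) with `|u(C)| = 1`: `Ω_W · √p = c_∞(W) · |Ω⁻(V)|`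
  have hpal := V.realPeriodRat_mul_sqrt_of_twist_of_neg (d := -(p : ℚ))
    (neg_lt_zero.mpr (by exact_mod_cast hp.out.pos)) W C hC
  have hsq : Real.sqrt (-((-(p : ℚ) : ℚ) : ℝ)) = Real.sqrt p := by push_cast; rw [neg_neg]
  have hu : |((C.u : ℚ) : ℝ)| = 1 := by
    rw [← Rat.cast_abs, abs_u_eq_one_of_twist_neg_prime_three_mod_four p hp4 V W hV C hC,
      Rat.cast_one]
  rw [hsq, hu, one_mul] at hpal
  set s : ℝ := Real.sqrt p with hs
  set c : ℕ := (W.baseChange ℝ).numRealComponents with hc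
  have hs0 : s ≠ 0 := Real.sqrt_ne_zero'.mpr (by exact_mod_cast hp.out.pos)
  have hc0 : (c : ℝ) ≠ 0 := by
    rw [hc, numRealComponents]
    split_ifs <;> norm_num
  have hsC0 : ((s : ℝ) : ℂ) ≠ 0 := by exact_mod_cast hs0
  have hcC0 : ((c : ℕ) : ℂ) ≠ 0 := by exact_mod_cast (show (c : ℝ) ≠ 0 from hc0)
  -- in `ℂ`: `Ω⁻_f = ϖ |Ω⁻(V)|` and `|Ω⁻(V)| · c = Ω_W · s`
  have hper : (minusPeriod f : ℂ) = (ϖ : ℂ) * (V.imaginaryPeriodRat : ℂ) := by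
    rw [← Complex.ofReal_ratCast, ← hϖ]
    push_cast
    ring
  have hpalC : (V.imaginaryPeriodRat : ℂ) * (c : ℂ) = (W.realPeriodRat : ℂ) * (s : ℂ) := by
    have h := congrArg (fun x : ℝ ↦ (x : ℂ)) hpal
    push_cast at h ⊢
    linear_combination -h
  rw [hper, hτ] at hB
  -- cancel `i`: `S⁻ ϖ |Ω⁻(V)| = s · L`
  have h1 : (legendreMinusSymbolSum f p : ℂ) * (ϖ : ℂ) * (V.imaginaryPeriodRat : ℂ) =
      (s : ℂ) * W.entireLFunction 1 := by
    have h0 : ((legendreMinusSymbolSum f p : ℂ) * (ϖ : ℂ) * (V.imaginaryPeriodRat : ℂ) -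
        (s : ℂ) * W.entireLFunction 1) * Complex.I = 0 := by
      linear_combination hB
    rcases mul_eq_zero.mp h0 with h | h
    · exact sub_eq_zero.mp h
    · exact absurd h Complex.I_ne_zero
  -- multiply by `c`, substitute Pal, cancel `s`: `L · c = S⁻ ϖ Ω_W`
  have key : W.entireLFunction 1 * (c : ℂ) =
      (legendreMinusSymbolSum f p : ℂ) * (ϖ : ℂ) * (W.realPeriodRat : ℂ) := by
    apply mul_left_cancel₀ hsC0
    linear_combination (-(c : ℂ)) * h1 + ((legendreMinusSymbolSum f p : ℂ) * (ϖ : ℂ)) * hpalC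
  rw [Rat.cast_div, div_mul_eq_mul_div, eq_div_iff (by push_cast; exact hcC0)]
  push_cast
  linear_combination key

end Signed

end Summit.BirchSwinnertonDyer.Rank1Residual.Additive

end
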